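import Literature.AlgebraicGeometry.Tropical.SchonIdeal
import Literature.AlgebraicGeometry.Resolution.RegularLocalRingsProofs

/-!
# `SchonResolves` (crux stmt-ResolutionOfSingularities-17234, route `TropicalLinks`), negative-side support:
# dictionary lemmas for the typed schön clause — initial forms are multiplicative,
# `in_φ⟨f⟩ = ⟨in_φ f⟩`, and a quotient by a square is regular at no prime

Refuter cdisprove seat (gen 2). General, sorry-free, definition-free lemmas used by the companion file
`Negative/AntecedentNeedsReembedding.lean` (the route-native witness showing that the `∃ (m, G)`
re-embedding choice in the crux's antecedent `SchonAt` is load-bearing); they are the first pieces of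
the Gröbner dictionary every prover on this route needs and belong in
`Literature/AlgebraicGeometry/Tropical/InitialIdeal` once a definition seat moves them:

* `initialForm_eq_of_forall` — characterisation of the initial form `in_φ f` (min-convention of
  `Literature.AlgebraicGeometry.Tropical.initialForm`);
* **`initialForm_mul`** — `in_φ(f g) = in_φ(f) · in_φ(g)` for coefficients without zero divisors,
  exponents with unique sums (e.g. `ℤ^N`) and an additive weight into an ordered cancellative monoid
  (Maclagan–Sturmfels §2.4/§2.6: the product of the lowest-weight parts is nonzero and is the
  lowest-weight part of the product);
* **`initialIdeal_span_singleton`** — `in_φ⟨f⟩ = ⟨in_φ f⟩` (hypersurfaces: the initial ideal of a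
  principal ideal is generated by the initial form of the generator);
* `exists_not_isRegularLocalRing_of_eq_span_sq` — for a nonzero non-unit `ε` of a domain `L`, the ring
  `L ⧸ ⟨ε²⟩` has a prime at which the localization is not a regular local ring (`ε̄` is a nonzero
  nilpotent at every prime; regular local rings are domains, Matsumura 14.3 =
  `Literature.AlgebraicGeometry.Resolution.isDomain_of_isRegularLocalRing`). This is the mechanism by
  which a NON-REDUCED initial degeneration violates the route's clause
  `∀ P, IsRegularLocalRing (Localization.AtPrime P)`.
-/

noncomputable section

-- single-problem summit: the doubled namespace component `ResolutionOfSingularities` is forced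
set_option linter.dupNamespace false

namespace Summit.ResolutionOfSingularities.ResolutionOfSingularities.Theorems.SchonResolves.Negative

open AddMonoidAlgebra Pointwise
open Literature.AlgebraicGeometry.Tropical

universe u v w

/-! ## §1 Initial forms are multiplicative over a domain; `in_φ⟨f⟩ = ⟨in_φ f⟩` -/

section Characterisation

variable {k : Type u} [Semiring k] {M : Type v} {Λ : Type w} [LinearOrder Λ]

/-- **Characterisation of the initial form.** If `g ≠ 0` agrees with `f` on the exponents of weight
`c`, every exponent of `g` has weight `c`, and every exponent of `f` has weight `≥ c`, then
`in_φ(f) = g`. [folklore] -/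
theorem initialForm_eq_of_forall {φ : M → Λ} {f g : AddMonoidAlgebra k M} {c : Λ}
    (hle : ∀ u ∈ f.coeff.support, c ≤ φ u)
    (heq : ∀ u, φ u = c → g.coeff u = f.coeff u)
    (hg : ∀ u ∈ g.coeff.support, φ u = c)
    (hg0 : g ≠ 0) :
    initialForm φ f = g := by
  classical
  obtain ⟨u0, hu0⟩ : g.coeff.support.Nonempty := by
    rw [Finsupp.support_nonempty_iff, ne_eq, coeff_eq_zero]
    exact hg0
  have hφu0 : φ u0 = c := hg u0 hu0
  have hfu0 : u0 ∈ f.coeff.support := by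
    rw [Finsupp.mem_support_iff] at hu0 ⊢
    rwa [← heq u0 hφu0]
  apply coeff_injective
  ext v
  rw [coeff_initialForm_apply]
  by_cases hv : φ v = c
  · rw [if_pos (fun u hu => by rw [hv]; exact hle u hu), heq v hv]
  · have hgv : g.coeff v = 0 := by
      by_contra h
      exact hv (hg v (Finsupp.mem_support_iff.2 h))
    rw [hgv]
    split_ifs with h
    · by_contra hfv
      exact hv (le_antisymm (hφu0 ▸ h u0 hfu0) (hle v (Finsupp.mem_support_iff.2 hfv)))
    · rfl

end Characterisation

section Multiplicativity

variable {k : Type u} [Semiring k] [NoZeroDivisors k] {M : Type v} [Add M] [UniqueSums M]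
  {Λ : Type w} [AddCommMonoid Λ] [LinearOrder Λ] [IsOrderedCancelAddMonoid Λ]

/-- **Initial forms are multiplicative over a domain**: `in_φ(f g) = in_φ(f) · in_φ(g)` for an
additive weight `φ` into an ordered cancellative monoid, coefficients without zero divisors and
exponents with unique sums (e.g. `ℤ^N`): the product of the lowest-weight parts is nonzero and is
exactly the lowest-weight part of the product. [cite: MaclaganSturmfels2015, §2.4 and §2.6] -/
theorem initialForm_mul (φ : M → Λ) (hadd : ∀ u v, φ (u + v) = φ u + φ v)
    (f g : AddMonoidAlgebra k M) :
    initialForm φ (f * g) = initialForm φ f * initialForm φ g := by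
  classical
  by_cases hf : f = 0
  · rw [hf, zero_mul, initialForm_zero, zero_mul]
  by_cases hg : g = 0
  · rw [hg, mul_zero, initialForm_zero, mul_zero]
  obtain ⟨ua, hua⟩ : (initialForm φ f).coeff.support.Nonempty := by
    rw [Finsupp.support_nonempty_iff, ne_eq, coeff_eq_zero]; exact initialForm_ne_zero φ hf
  obtain ⟨ub, hub⟩ : (initialForm φ g).coeff.support.Nonempty := by
    rw [Finsupp.support_nonempty_iff, ne_eq, coeff_eq_zero]; exact initialForm_ne_zero φ hg
  have haf : ∀ u ∈ f.coeff.support, φ ua ≤ φ u := fun u hu =>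
    weight_le_of_mem_support_initialForm φ f hua hu
  have hbg : ∀ v ∈ g.coeff.support, φ ub ≤ φ v := fun v hv =>
    weight_le_of_mem_support_initialForm φ g hub hv
  have hinf : ∀ u, u ∈ (initialForm φ f).coeff.support ↔ u ∈ f.coeff.support ∧ φ u = φ ua := by
    intro u
    rw [support_initialForm, Finset.mem_filter]
    constructor
    · rintro ⟨hu, hmin⟩
      exact ⟨hu, le_antisymm (hmin ua (support_initialForm_subset φ f hua)) (haf u hu)⟩
    · rintro ⟨hu, hφ⟩
      exact ⟨hu, fun u' hu' => by rw [hφ]; exact haf u' hu'⟩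
  have hing : ∀ v, v ∈ (initialForm φ g).coeff.support ↔ v ∈ g.coeff.support ∧ φ v = φ ub := by
    intro v
    rw [support_initialForm, Finset.mem_filter]
    constructor
    · rintro ⟨hv, hmin⟩
      exact ⟨hv, le_antisymm (hmin ub (support_initialForm_subset φ g hub)) (hbg v hv)⟩
    · rintro ⟨hv, hφ⟩
      exact ⟨hv, fun v' hv' => by rw [hφ]; exact hbg v' hv'⟩
  have hcf : ∀ u ∈ (initialForm φ f).coeff.support, (initialForm φ f).coeff u = f.coeff u := by
    intro u hu
    rw [support_initialForm, Finset.mem_filter] at hu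
    rw [coeff_initialForm_apply, if_pos hu.2]
  have hcg : ∀ v ∈ (initialForm φ g).coeff.support, (initialForm φ g).coeff v = g.coeff v := by
    intro v hv
    rw [support_initialForm, Finset.mem_filter] at hv
    rw [coeff_initialForm_apply, if_pos hv.2]
  apply initialForm_eq_of_forall (c := φ ua + φ ub)
  · intro m hm
    obtain ⟨u, hu, v, hv, rfl⟩ := Finset.mem_add.1 (support_coeff_mul_subset f g hm)
    rw [hadd]
    exact add_le_add (haf u hu) (hbg v hv)
  · intro m hm
    simp only [coeff_mul, Finsupp.sum]
    calc ∑ u ∈ (initialForm φ f).coeff.support, ∑ v ∈ (initialForm φ g).coeff.support,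
            (if u + v = m then (initialForm φ f).coeff u * (initialForm φ g).coeff v else 0)
        = ∑ u ∈ (initialForm φ f).coeff.support, ∑ v ∈ (initialForm φ g).coeff.support,
            (if u + v = m then f.coeff u * g.coeff v else 0) := by
          refine Finset.sum_congr rfl fun u hu => Finset.sum_congr rfl fun v hv => ?_
          rw [hcf u hu, hcg v hv]
      _ = ∑ u ∈ (initialForm φ f).coeff.support, ∑ v ∈ g.coeff.support,
            (if u + v = m then f.coeff u * g.coeff v else 0) := by
          refine Finset.sum_congr rfl fun u hu =>
            Finset.sum_subset (support_initialForm_subset φ g) ?_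
          intro v hv hvn
          rw [if_neg]
          intro huv
          apply hvn
          rw [hing]
          refine ⟨hv, ?_⟩
          have h1 : φ u + φ v = φ ua + φ ub := by rw [← hadd, huv, hm]
          rw [((hinf u).1 hu).2] at h1
          exact add_left_cancel h1
      _ = ∑ u ∈ f.coeff.support, ∑ v ∈ g.coeff.support,
            (if u + v = m then f.coeff u * g.coeff v else 0) := by
          refine Finset.sum_subset (support_initialForm_subset φ f) ?_
          intro u hu hun
          refine Finset.sum_eq_zero fun v hv => ?_
          rw [if_neg]
          intro huv
          apply hun
          rw [hinf]
          refine ⟨hu, le_antisymm ?_ (haf u hu)⟩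
          have h1 : φ u + φ v = φ ua + φ ub := by rw [← hadd, huv, hm]
          by_contra hlt
          push Not at hlt
          exact absurd h1 (ne_of_gt (add_lt_add_of_lt_of_le hlt (hbg v hv)))
  · intro m hm
    obtain ⟨u, hu, v, hv, rfl⟩ := Finset.mem_add.1 (support_coeff_mul_subset _ _ hm)
    rw [hadd, ((hinf u).1 hu).2, ((hing v).1 hv).2]
  · exact mul_ne_zero (initialForm_ne_zero φ hf) (initialForm_ne_zero φ hg)

end Multiplicativity

section PrincipalIdeal

variable {k : Type u} [CommSemiring k] [NoZeroDivisors k] {M : Type v} [AddCommMonoid M] [UniqueSums M]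
  {Λ : Type w} [AddCommMonoid Λ] [LinearOrder Λ] [IsOrderedCancelAddMonoid Λ]

/-- **The initial ideal of a principal ideal is principal, generated by the initial form of the
generator** (over a domain, e.g. every Laurent ring `k[ℤ^N]` over a field):
`in_φ(⟨f⟩) = ⟨in_φ(f)⟩`, because `in_φ(a f) = in_φ(a) in_φ(f)`. [cite: MaclaganSturmfels2015, §2.6] -/
theorem initialIdeal_span_singleton (φ : M → Λ) (hadd : ∀ u v, φ (u + v) = φ u + φ v)
    (f : AddMonoidAlgebra k M) :
    initialIdeal φ (Ideal.span {f}) = Ideal.span {initialForm φ f} := by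
  apply le_antisymm
  · unfold initialIdeal
    rw [Ideal.span_le]
    rintro _ ⟨h, hh, rfl⟩
    obtain ⟨a, rfl⟩ := Ideal.mem_span_singleton'.1 hh
    rw [SetLike.mem_coe, initialForm_mul φ hadd]
    exact Ideal.mul_mem_left _ _ (Ideal.mem_span_singleton_self _)
  · rw [Ideal.span_le, Set.singleton_subset_iff]
    exact initialForm_mem_initialIdeal φ (Ideal.mem_span_singleton_self f)

end PrincipalIdeal

/-! ## §2 A degeneration `L ⧸ ⟨ε²⟩` is regular at NO prime -/

/-- **Quotients by a square are nowhere regular.** In a domain `L`, for a nonzero non-unit `ε`,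
the ring `L ⧸ ⟨ε²⟩` has a prime ideal `P` at which the localization is NOT a regular local ring:
`ε̄` is a nonzero nilpotent of `(L ⧸ ⟨ε²⟩)_P` for every prime `P` (its annihilator is `⟨ε̄⟩ ⊆ P`),
while regular local rings are domains (Matsumura 14.3, in tree). Stated with an equation
`J = ⟨ε²⟩` so that it applies to syntactically different presentations of the ideal. [folklore] -/
theorem exists_not_isRegularLocalRing_of_eq_span_sq {L : Type u} [CommRing L] [IsDomain L]
    {ε : L} (hε0 : ε ≠ 0) (hεu : ¬ IsUnit ε) {J : Ideal L} (hJ : J = Ideal.span {ε ^ 2}) :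
    ∃ (P : Ideal (L ⧸ J)) (_ : P.IsPrime), ¬ IsRegularLocalRing (Localization.AtPrime P) := by
  have hJtop : J ≠ ⊤ := by
    rw [hJ, Ne, Ideal.span_singleton_eq_top]
    exact fun h => hεu ((isUnit_pow_iff two_ne_zero).1 h)
  haveI : Nontrivial (L ⧸ J) := Ideal.Quotient.nontrivial_iff.mpr hJtop
  obtain ⟨P, hP⟩ := Ideal.exists_maximal (L ⧸ J)
  haveI : P.IsPrime := hP.isPrime
  refine ⟨P, hP.isPrime, fun hreg => ?_⟩
  haveI : IsDomain (Localization.AtPrime P) :=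
    Literature.AlgebraicGeometry.Resolution.isDomain_of_isRegularLocalRing (Localization.AtPrime P)
  have he2 : (Ideal.Quotient.mk J ε) ^ 2 = 0 := by
    rw [← map_pow, Ideal.Quotient.eq_zero_iff_mem, hJ]
    exact Ideal.mem_span_singleton_self _
  have heP : Ideal.Quotient.mk J ε ∈ P :=
    Ideal.IsPrime.mem_of_pow_mem inferInstance 2 (by rw [he2]; exact P.zero_mem)
  have himg : algebraMap (L ⧸ J) (Localization.AtPrime P) (Ideal.Quotient.mk J ε) = 0 := by
    have h2 : (algebraMap (L ⧸ J) (Localization.AtPrime P) (Ideal.Quotient.mk J ε)) ^ 2 = 0 := by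
      rw [← map_pow, he2, map_zero]
    exact (pow_eq_zero_iff two_ne_zero).1 h2
  rw [IsLocalization.map_eq_zero_iff P.primeCompl] at himg
  obtain ⟨⟨s, hs⟩, hse⟩ := himg
  obtain ⟨s', rfl⟩ := Ideal.Quotient.mk_surjective s
  have hmem : s' * ε ∈ J := by
    rw [← Ideal.Quotient.eq_zero_iff_mem, map_mul]
    exact hse
  rw [hJ, Ideal.mem_span_singleton'] at hmem
  obtain ⟨t, ht⟩ := hmem
  have hs' : s' = t * ε := by
    have h3 : (t * ε) * ε = s' * ε := by rw [mul_assoc, ← pow_two]; exact ht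
    exact (mul_right_cancel₀ hε0 h3).symm
  apply hs
  show Ideal.Quotient.mk J s' ∈ P
  rw [hs', map_mul]
  exact P.mul_mem_left _ heP

end Summit.ResolutionOfSingularities.ResolutionOfSingularities.Theorems.SchonResolves.Negative

end
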